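import Literature.NumberTheory.Automorphic.ShimuraCurveTakahashiCoordinateInputs
import Summits.BirchSwinnertonDyer.BirchSwinnertonDyer.Theorems.RamifiedHeegnerPairLeafPartnerOrdersDictStable
import HarnessLib

/-!
# Route `RamifiedHeegnerPair`, crux U₁ `LeafRankOneUpperAtThree` (stmt-BirchSwinnertonDyer-26022), line `partnerdescent` —
# the DICT stub loses a SECOND conjunct: **the rank-one `a(W′)`-eigen-line is paid by Takahashi's Thm. 2.3 (PRINT-COORD)**

HONEST FRAMING. Theorems only; helper file (`--supports stmt-BirchSwinnertonDyer-26022`); elementary linear algebra over the tree's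
`Brandt.xi` ∕ `XiSetup.xi` (‹BrandtXi›: junk value `0` off rank one) and the corollary `takahashi2001_thm_2_3_shimura_disc.xi_pos` of the
cite-only named fact `takahashi2001_thm_2_3_shimura_disc` (‹ShimuraCurveTakahashiCoordinateInputs›) which the line ALREADY lists among its
fourteen print facts (skeleton `stub_printFactsAll`, second group, conjunct 2); no number theory is proved here, no new named fact, no
`sorry`; nothing booked; BSD is proved for no curve. Lead prover bsd-line-rhp-p2 g66, 2026-08-31.

WHY. The stub DICT of skeleton v11 (`Partnerdescent.LeafHeckeDictionaryAtThree`) asks, inside one existential, for «the `a(W′)`-eigen-lattice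
of the Brandt matrices of `S` (type `(pM, d)`, primes `∤ pMd`) has `ℤ`-rank one» — the Jacquet–Langlands ∕ strong-multiplicity-one input.
But `takahashi2001_thm_2_3_shimura_disc` gives, at the SAME binders, `P.deg · i = ξ_S(a(W′)) · j` with `0 < P.deg`, `0 < i`, hence
`0 < ξ_S(a(W′))` (`xi_pos`, tree); and `ξ_S(λ) = Brandt.xi w (eigenLattice (pM·d) T λ)` is by DEFINITION `0` unless that lattice is a line
`ℤ φ`, `φ ≠ 0` (`Brandt.xi_of_not_isLine`). So the rank-one conjunct FOLLOWS from a print fact the line already carries; the next skeleton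
(v12 ∕ v25) files DICT without it (and without the Hecke-stability clause, ‹…DictStable›): DICT♭ = DICT minus TWO conjuncts, monotone.

WHAT.
* §1 `finrank_eq_one_of_xi_pos` — `0 < Brandt.xi w L ⟹ finrank ℤ L = 1`; `finrank_eigenLattice_eq_one_of_xi_pos` — for a setup `S`,
  `0 < S.xi λ ⟹ finrank ℤ (eigenLattice (N⁺N⁻) (Brandt.matrix S.O) λ) = 1` (any `Fintype` instance on `Cls O`).
* §2 `finrank_eigenLattice_eq_one_of_thm_2_3` — RANK-ONE at the binders of DICT from `takahashi2001_thm_2_3_shimura_disc`.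
* §3 `leafHeckeDictionaryReduced_of_rankOne` — DICT♭ (minus stability AND rank one) ⟹ DICT minus stability (the hypothesis of
  ‹…DictStable› `leafHeckeDictionary_of_reduced`), both bodies VERBATIM; `leafHeckeDictionary_of_reduced₂` — the composite DICT♭ ⟹ DICT.
[cite: Takahashi2001, §2 p. 78 ("`L_r(J)` is a free `ℤ`-module of rank one"), Thm. 2.3 (p. 79), Thm. 3.2 (a) (p. 82)] [cite: PollackWeston2011, §2.1]
-/

set_option linter.dupNamespace false
set_option autoImplicit false

noncomputable section

namespace Summit.BirchSwinnertonDyer.BirchSwinnertonDyer.Theorems.LeafPartnerOrders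

open scoped Pointwise Matrix
open Matrix Literature.NumberTheory.Automorphic Literature.NumberTheory.Automorphic.Brandt Literature.NumberTheory.EllipticCurves

/-! ### §1 `ξ > 0` forces a line -/

/-- **`ξ > 0` forces rank one.** `Brandt.xi w L` is the junk value `0` unless `L = ℤ φ` with `φ ≠ 0`; and such a line has `ℤ`-rank one
(`ℤ ≃ ℤ φ`, `ℤ^ι` being torsion-free). [folklore] -/
theorem finrank_eq_one_of_xi_pos {ι : Type*} [Fintype ι] (w : ι → ℕ) {L : Submodule ℤ (ι → ℤ)} (h : 0 < Brandt.xi w L) :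
    Module.finrank ℤ L = 1 := by
  by_contra hne
  have hnot : ¬ ∃ φ : ι → ℤ, φ ≠ 0 ∧ L = ℤ ∙ φ := by
    rintro ⟨φ, hφ, rfl⟩
    exact hne (by rw [← (LinearEquiv.toSpanNonzeroSingleton ℤ (ι → ℤ) φ hφ).finrank_eq, Module.finrank_self])
  rw [Brandt.xi_of_not_isLine w hnot] at h
  exact lt_irrefl 0 h

variable {Nplus Nminus : ℕ} (S : XiSetup Nplus Nminus)

/-- **`ξ_S(λ) > 0` forces the eigen-lattice of `λ` to be a line**: `finrank ℤ (eigenLattice (N⁺N⁻) (Brandt.matrix S.O) λ) = 1`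
(for any `Fintype` structure on `Cls O`: `XiSetup.xi` unfolds to `Brandt.xi` of that lattice, `xiOfOrder_eq`). [cite: PollackWeston2011, §2.1] -/
theorem finrank_eigenLattice_eq_one_of_xi_pos [Fintype (ClassSet S.O)] {lam : ℕ → ℤ} (h : 0 < S.xi lam) :
    Module.finrank ℤ (eigenLattice (Nplus * Nminus) (Brandt.matrix S.O) lam) = 1 := by
  rw [XiSetup.xi, xiOfOrder_eq] at h
  exact finrank_eq_one_of_xi_pos _ h

/-! ### §2 RANK-ONE at the DICT binders from Takahashi's Thm. 2.3 -/

/-- **RANK-ONE from PRINT-COORD.** At the binders of DICT (admissible `N = DM`, `D = p·d`, `X`, `W` of conductor `N`, a class-minimal datum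
`P : X → W′`, a Brandt setup `S` of type `(pM, d)`): the `a(W′)`-eigen-lattice of the Brandt matrices has `ℤ`-rank one — because
`takahashi2001_thm_2_3_shimura_disc` forces `0 < ξ_S(a(W′))` (`xi_pos`). No hypothesis at `3` or at `d` is used.
[cite: Takahashi2001, §2 p. 78, Thm. 2.3 (p. 79), Thm. 3.2 (a) (p. 82)] -/
theorem finrank_eigenLattice_eq_one_of_thm_2_3 (hdisc : takahashi2001_thm_2_3_shimura_disc)
    {N D M p d : ℕ} (hp : p.Prime) (hD : D = p * d) (hadm : IsAdmissibleFactorization N D M)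
    (X : ShimuraCurveData D M) (W : WeierstrassCurve ℚ) [W.IsElliptic] (hN : W.conductorNorm ℤ = N)
    (W' : WeierstrassCurve ℚ) [W'.IsElliptic] (P : ShimuraParametrizationData X W') (hP : P.IsMinimalFor W)
    (S : Brandt.XiSetup (p * M) d) [Fintype (ClassSet S.O)] :
    Module.finrank ℤ (eigenLattice (p * M * d) (Brandt.matrix S.O) (fun n ↦ W'.LFunction n)) = 1 :=
  finrank_eigenLattice_eq_one_of_xi_pos S (takahashi2001_thm_2_3_shimura_disc.xi_pos hdisc hp hD hadm X W hN W' P hP S)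

/-! ### §3 DICT♭ ⟹ DICT with the stub's binders -/

/-- **DICT♭ ⟹ DICT minus stability.** The v12 stub text `Partnerdescent.LeafHeckeDictionaryReducedAtThree` (= DICT with the Hecke-stability
clause AND the rank-one conjunct deleted) implies, granted `takahashi2001_thm_2_3_shimura_disc`, the hypothesis of ‹…DictStable›
`leafHeckeDictionary_of_reduced` (DICT with only the stability clause deleted). Both bodies VERBATIM. [cite: Takahashi2001, §2 p. 78, Thm. 2.3, Prop. 3.1, Thm. 3.2 (a)]
[cite: Ribet1990, Thm. 4.1] [cite: PapikianRabinoff2016, §3 ¶23, Lemma 24] -/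
theorem leafHeckeDictionaryReduced_of_rankOne (hdisc : takahashi2001_thm_2_3_shimura_disc)
    (hred₂ : ∀ {N D M p d : ℕ}, p.Prime → D = p * d → IsAdmissibleFactorization N D M →
      ∀ (X : ShimuraCurveData D M) (W : WeierstrassCurve ℚ) [W.IsElliptic] [W.IsGloballyMinimal],
        W.conductorNorm ℤ = N → ¬ 3 ∣ N → W.HasIrreducibleModPGaloisRep 3 →
      ∀ [Fact d.Prime], d ≠ p → W.HasSplitMultiplicativeReductionAtPrime d →
      ∀ (W' : WeierstrassCurve ℚ) [W'.IsElliptic] (P : ShimuraParametrizationData X W'), P.IsMinimalFor W →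
      ∀ (S : Brandt.XiSetup (p * M) d) [Fintype (ClassSet S.O)] [DecidableEq (ClassSet S.O)]
        (B : Submodule ℤ (ClassSet S.O → ℤ)), (∀ v, v ∈ B ↔ ∑ c, v c = 0) →
      ∃ (Y : Submodule ℤ (ClassSet S.O → ℤ)) (pb : ℤ →ₗ[ℤ] Y) (pf : Y →ₗ[ℤ] ℤ)
        (uY : Matrix (ClassSet S.O) (ClassSet S.O) ℤ) (N₀ : ℤ),
        (∀ (a : ℤ) (y : Y), ∑ k, (weight S.O k : ℤ) * (pb a : ClassSet S.O → ℤ) k * (y : ClassSet S.O → ℤ) k =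
          ((W'.minimalDiscriminantNorm ℤ).factorization p : ℤ) * a * pf y) ∧
        (∀ a : ℤ, pf (pb a) = (P.deg : ℤ) * a) ∧ Function.Surjective pf ∧
        (∀ (k : ℤ) (v : ClassSet S.O → ℤ), k ≠ 0 → k • v ∈ Y → v ∈ Y) ∧
        (pb 1 : ClassSet S.O → ℤ) ∈ eigenLattice (p * M * d) (Brandt.matrix S.O) (fun n ↦ W'.LFunction n) ∧
        Y ≤ B ∧
        uY ∈ S.fullHeckeAlgebra ∧ N₀ ≠ 0 ∧ (∀ y ∈ Y, uY *ᵥ y = N₀ • y) ∧ (∀ b ∈ B, uY *ᵥ b ∈ Y) ∧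
        (∀ C ∈ S.fullHeckeAlgebra, ∀ a : ℤ,
          (∀ y (hy : y ∈ Y), (P.deg : ℤ) • (C *ᵥ y) = a • pf ⟨y, hy⟩ • (pb 1 : ClassSet S.O → ℤ)) → (P.deg : ℤ) ∣ a)) :
    ∀ {N D M p d : ℕ}, p.Prime → D = p * d → IsAdmissibleFactorization N D M →
      ∀ (X : ShimuraCurveData D M) (W : WeierstrassCurve ℚ) [W.IsElliptic] [W.IsGloballyMinimal],
        W.conductorNorm ℤ = N → ¬ 3 ∣ N → W.HasIrreducibleModPGaloisRep 3 →
      ∀ [Fact d.Prime], d ≠ p → W.HasSplitMultiplicativeReductionAtPrime d →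
      ∀ (W' : WeierstrassCurve ℚ) [W'.IsElliptic] (P : ShimuraParametrizationData X W'), P.IsMinimalFor W →
      ∀ (S : Brandt.XiSetup (p * M) d) [Fintype (ClassSet S.O)] [DecidableEq (ClassSet S.O)]
        (B : Submodule ℤ (ClassSet S.O → ℤ)), (∀ v, v ∈ B ↔ ∑ c, v c = 0) →
      ∃ (Y : Submodule ℤ (ClassSet S.O → ℤ)) (pb : ℤ →ₗ[ℤ] Y) (pf : Y →ₗ[ℤ] ℤ)
        (uY : Matrix (ClassSet S.O) (ClassSet S.O) ℤ) (N₀ : ℤ),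
        (∀ (a : ℤ) (y : Y), ∑ k, (weight S.O k : ℤ) * (pb a : ClassSet S.O → ℤ) k * (y : ClassSet S.O → ℤ) k =
          ((W'.minimalDiscriminantNorm ℤ).factorization p : ℤ) * a * pf y) ∧
        (∀ a : ℤ, pf (pb a) = (P.deg : ℤ) * a) ∧ Function.Surjective pf ∧
        (∀ (k : ℤ) (v : ClassSet S.O → ℤ), k ≠ 0 → k • v ∈ Y → v ∈ Y) ∧
        Module.finrank ℤ (eigenLattice (p * M * d) (Brandt.matrix S.O) (fun n ↦ W'.LFunction n)) = 1 ∧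
        (pb 1 : ClassSet S.O → ℤ) ∈ eigenLattice (p * M * d) (Brandt.matrix S.O) (fun n ↦ W'.LFunction n) ∧
        Y ≤ B ∧
        uY ∈ S.fullHeckeAlgebra ∧ N₀ ≠ 0 ∧ (∀ y ∈ Y, uY *ᵥ y = N₀ • y) ∧ (∀ b ∈ B, uY *ᵥ b ∈ Y) ∧
        (∀ C ∈ S.fullHeckeAlgebra, ∀ a : ℤ,
          (∀ y (hy : y ∈ Y), (P.deg : ℤ) • (C *ᵥ y) = a • pf ⟨y, hy⟩ • (pb 1 : ClassSet S.O → ℤ)) → (P.deg : ℤ) ∣ a) := by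
  intro N D M p d hp hD hadm X W _ _ hN h3 hirr _ hdp hsplit W' _ P hP S _ _ B hB
  obtain ⟨Y, pb, pf, uY, N₀, hadjY, hδ, hsurj, hYsat, hmem, hYB, huYG, hN₀, huY, huYB, hC5⟩ :=
    hred₂ hp hD hadm X W hN h3 hirr hdp hsplit W' P hP S B hB
  exact ⟨Y, pb, pf, uY, N₀, hadjY, hδ, hsurj, hYsat, finrank_eigenLattice_eq_one_of_thm_2_3 hdisc hp hD hadm X W hN W' P hP S,
    hmem, hYB, huYG, hN₀, huY, huYB, hC5⟩

/-- **DICT♭ ⟹ DICT** (the composite used by skeleton v12 ∕ v25): from `takahashi2001_thm_2_3_shimura_disc` and the v12 stub DICT♭, the v11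
stub text DICT (= `hDICT` of `cokernelFifth_of_canonicalInputs`) — rank one by §2, Hecke stability by ‹…DictStable›. Bodies VERBATIM.
[cite: Takahashi2001, Thm. 2.3, Prop. 3.1, Thm. 3.2 (a)] [cite: Ribet1990, Prop. 3.1, Thm. 4.1] [cite: PapikianRabinoff2016, §3 ¶23, Lemma 24] -/
theorem leafHeckeDictionary_of_reduced₂ (hdisc : takahashi2001_thm_2_3_shimura_disc)
    (hred₂ : ∀ {N D M p d : ℕ}, p.Prime → D = p * d → IsAdmissibleFactorization N D M →
      ∀ (X : ShimuraCurveData D M) (W : WeierstrassCurve ℚ) [W.IsElliptic] [W.IsGloballyMinimal],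
        W.conductorNorm ℤ = N → ¬ 3 ∣ N → W.HasIrreducibleModPGaloisRep 3 →
      ∀ [Fact d.Prime], d ≠ p → W.HasSplitMultiplicativeReductionAtPrime d →
      ∀ (W' : WeierstrassCurve ℚ) [W'.IsElliptic] (P : ShimuraParametrizationData X W'), P.IsMinimalFor W →
      ∀ (S : Brandt.XiSetup (p * M) d) [Fintype (ClassSet S.O)] [DecidableEq (ClassSet S.O)]
        (B : Submodule ℤ (ClassSet S.O → ℤ)), (∀ v, v ∈ B ↔ ∑ c, v c = 0) →
      ∃ (Y : Submodule ℤ (ClassSet S.O → ℤ)) (pb : ℤ →ₗ[ℤ] Y) (pf : Y →ₗ[ℤ] ℤ)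
        (uY : Matrix (ClassSet S.O) (ClassSet S.O) ℤ) (N₀ : ℤ),
        (∀ (a : ℤ) (y : Y), ∑ k, (weight S.O k : ℤ) * (pb a : ClassSet S.O → ℤ) k * (y : ClassSet S.O → ℤ) k =
          ((W'.minimalDiscriminantNorm ℤ).factorization p : ℤ) * a * pf y) ∧
        (∀ a : ℤ, pf (pb a) = (P.deg : ℤ) * a) ∧ Function.Surjective pf ∧
        (∀ (k : ℤ) (v : ClassSet S.O → ℤ), k ≠ 0 → k • v ∈ Y → v ∈ Y) ∧
        (pb 1 : ClassSet S.O → ℤ) ∈ eigenLattice (p * M * d) (Brandt.matrix S.O) (fun n ↦ W'.LFunction n) ∧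
        Y ≤ B ∧
        uY ∈ S.fullHeckeAlgebra ∧ N₀ ≠ 0 ∧ (∀ y ∈ Y, uY *ᵥ y = N₀ • y) ∧ (∀ b ∈ B, uY *ᵥ b ∈ Y) ∧
        (∀ C ∈ S.fullHeckeAlgebra, ∀ a : ℤ,
          (∀ y (hy : y ∈ Y), (P.deg : ℤ) • (C *ᵥ y) = a • pf ⟨y, hy⟩ • (pb 1 : ClassSet S.O → ℤ)) → (P.deg : ℤ) ∣ a)) :
    ∀ {N D M p d : ℕ}, p.Prime → D = p * d → IsAdmissibleFactorization N D M →
      ∀ (X : ShimuraCurveData D M) (W : WeierstrassCurve ℚ) [W.IsElliptic] [W.IsGloballyMinimal],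
        W.conductorNorm ℤ = N → ¬ 3 ∣ N → W.HasIrreducibleModPGaloisRep 3 →
      ∀ [Fact d.Prime], d ≠ p → W.HasSplitMultiplicativeReductionAtPrime d →
      ∀ (W' : WeierstrassCurve ℚ) [W'.IsElliptic] (P : ShimuraParametrizationData X W'), P.IsMinimalFor W →
      ∀ (S : Brandt.XiSetup (p * M) d) [Fintype (ClassSet S.O)] [DecidableEq (ClassSet S.O)]
        (B : Submodule ℤ (ClassSet S.O → ℤ)), (∀ v, v ∈ B ↔ ∑ c, v c = 0) →
      ∃ (Y : Submodule ℤ (ClassSet S.O → ℤ)) (pb : ℤ →ₗ[ℤ] Y) (pf : Y →ₗ[ℤ] ℤ)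
        (uY : Matrix (ClassSet S.O) (ClassSet S.O) ℤ) (N₀ : ℤ),
        (∀ (a : ℤ) (y : Y), ∑ k, (weight S.O k : ℤ) * (pb a : ClassSet S.O → ℤ) k * (y : ClassSet S.O → ℤ) k =
          ((W'.minimalDiscriminantNorm ℤ).factorization p : ℤ) * a * pf y) ∧
        (∀ a : ℤ, pf (pb a) = (P.deg : ℤ) * a) ∧ Function.Surjective pf ∧
        (∀ (k : ℤ) (v : ClassSet S.O → ℤ), k ≠ 0 → k • v ∈ Y → v ∈ Y) ∧
        Module.finrank ℤ (eigenLattice (p * M * d) (Brandt.matrix S.O) (fun n ↦ W'.LFunction n)) = 1 ∧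
        (pb 1 : ClassSet S.O → ℤ) ∈ eigenLattice (p * M * d) (Brandt.matrix S.O) (fun n ↦ W'.LFunction n) ∧
        Y ≤ B ∧ (∀ q : ℕ, q.Prime → ∀ y ∈ Y, S.heckeAt q *ᵥ y ∈ Y) ∧
        uY ∈ S.fullHeckeAlgebra ∧ N₀ ≠ 0 ∧ (∀ y ∈ Y, uY *ᵥ y = N₀ • y) ∧ (∀ b ∈ B, uY *ᵥ b ∈ Y) ∧
        (∀ C ∈ S.fullHeckeAlgebra, ∀ a : ℤ,
          (∀ y (hy : y ∈ Y), (P.deg : ℤ) • (C *ᵥ y) = a • pf ⟨y, hy⟩ • (pb 1 : ClassSet S.O → ℤ)) → (P.deg : ℤ) ∣ a) :=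
  leafHeckeDictionary_of_reduced (leafHeckeDictionaryReduced_of_rankOne hdisc hred₂)

end Summit.BirchSwinnertonDyer.BirchSwinnertonDyer.Theorems.LeafPartnerOrders

end
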